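import Summits.Ventures.PercRepro.Night2RigidMass
import Summits.Ventures.PercRepro.Night2RigidSum

/-!
# PercRepro — THE RIGID CELL `(q − 1, q − 2)` AT EVERY `q ≥ 4` (night-2, gen 18)

**`localShadowHall_rigid`**: for a simple matroid `M`, a rank-`(q+1)` flat `G` with `|E ∖ G| = q − 1` and
`kColoops (M|G) = q − 2`, `q ≥ 4`, the local form (LI_G) holds.  The certificate is the fair-share loss routing
(`localShadowHall_of_lossFair`): a loss sits only at a pair `B = K ∪ {x, y}` (`loss_eq_zero_of_three_le`), its
targets are the `2^{n−3} − 1` sets `B ∪ {z} ∪ X` (`card_tgtSets`, `n = |G ∖ K|`), each carrying loss mass at most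
`3 C(|S ∖ K|, 3) λ/(2^{n−3} − 1)` (`pi2Mass_le_rigid`) and residual capacity at least `c′` (or `c″` when
`|G ∖ S| ≤ 1`; `cap2_ge_cPrime`, `cap2_ge_cDouble`); the size-bound lemma `lossIncome_ge_of_bounds` turns the
per-loss inequality into `rigidSum n q ≥ 1` (`one_le_rigidSum`, i.e. the inequality `(8′)` of the paper).
This is the open `(7, 5)` cell `(4, 3)` at `q = 5`, g13's cell `(3, 2)` at `q = 4`, and one cell per row at every
`q ≥ 4` — `proofs/NIGHT-2-g18.md` §7.
-/

namespace PercRepro.Shadow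

open Finset PerFlat ThmH

variable {α : Type*} [DecidableEq α] {M : Matroid α} [M.Finite]

/-- `cPrime = cp`, `cDouble = cpp`, `lambdaR = lamRig` (the closed forms). -/
theorem cPrime_eq (q : ℕ) (hq : 1 ≤ q) : cPrime q = Rigid.cp q := by
  unfold cPrime cRig Rigid.cp phiQ
  have hq0 : (q : ℚ) ≠ 0 := by exact_mod_cast (by omega : q ≠ 0)
  have hq1 : (q : ℚ) + 1 ≠ 0 := by positivity
  field_simp
  ring

/-- `cDouble = cpp`. -/
theorem cDouble_eq (q : ℕ) : cDouble q = Rigid.cpp q := by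
  unfold cDouble Rigid.cpp phiQ
  have hq1 : (q : ℚ) + 1 ≠ 0 := by positivity
  field_simp
  ring

/-- `lambdaR = lamRig`. -/
theorem lambdaR_eq (q : ℕ) (hq : 1 ≤ q) : lambdaR q = Rigid.lamRig q := by
  unfold lambdaR Rigid.lamRig phiQ
  have hq0 : (q : ℚ) ≠ 0 := by exact_mod_cast (by omega : q ≠ 0)
  have hq1 : (q : ℚ) + 1 ≠ 0 := by positivity
  field_simp
  ring

/-- `c′ > 0` for `q ≥ 1`. -/
theorem cPrime_pos {q : ℕ} (hq : 1 ≤ q) : 0 < cPrime q := by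
  rw [cPrime_eq q hq]; unfold Rigid.cp
  have : (1 : ℚ) ≤ (q : ℚ) := by exact_mod_cast hq
  positivity

/-- `c″ > 0` for `q ≥ 1`. -/
theorem cDouble_pos {q : ℕ} (hq : 1 ≤ q) : 0 < cDouble q := by
  rw [cDouble_eq q]; unfold Rigid.cpp
  have : (1 : ℚ) ≤ (q : ℚ) := by exact_mod_cast hq
  apply div_pos _ (by positivity)
  nlinarith

open scoped Classical in
/-- Rigid cell: a thin pair member forces at least five points off the coloops. -/
theorem five_le_of_pair {q : ℕ} {G : Finset α} (hG : G ∈ flatsQ M (q + 1)) (hd : (gr M \ G).card = q - 1)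
    (hk : kColoops M G + 2 = q) {B : Finset α} (hB : B ∈ thinMembers M q G)
    (h2 : (B \ coloops M G).card = 2) : 5 ≤ G.card - kColoops M G := by
  have hd' : (gr M \ G).card ≤ q := by omega
  have hB' : B ∈ membersIn M (Uq M (q + 2) q) G := (mem_thinMembers.1 hB).1
  have hBU : B ∈ Uq M (q + 2) q := (mem_membersIn.1 hB').1
  have hBG : B ⊆ G := (subset_clF hBU).trans (mem_membersIn.1 hB').2
  have hK := coloops_subset_of_mem_thinMembers hG hd' hB
  have hGg : G ⊆ gr M := (mem_flatsQ.1 hG).1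
  -- ρ(E ∖ B) = q + 2 ≤ ρ(E ∖ G) + ρ(G ∖ B) ≤ (q − 1) + |G ∖ B|
  have hr : M.eRk ((gr M \ B : Finset α) : Set α) = ((q + 2 : ℕ) : ℕ∞) := (mem_Uq.1 hBU).2.2
  have hsplit : gr M \ B = (gr M \ G) ∪ (G \ B) := by
    ext x; simp only [Finset.mem_sdiff, Finset.mem_union]
    constructor
    · rintro ⟨hx, hxB⟩; by_cases hxG : x ∈ G
      · exact Or.inr ⟨hxG, hxB⟩
      · exact Or.inl ⟨hx, hxG⟩
    · rintro (⟨hx, hxG⟩ | ⟨hxG, hxB⟩)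
      · exact ⟨hx, fun h => hxG (hBG h)⟩
      · exact ⟨hGg hxG, hxB⟩
  have hsub : M.eRk ((gr M \ B : Finset α) : Set α) ≤
      M.eRk ((gr M \ G : Finset α) : Set α) + M.eRk ((G \ B : Finset α) : Set α) := by
    rw [hsplit, Finset.coe_union]
    exact M.eRk_union_le_eRk_add_eRk _ _
  have h1 : M.eRk ((gr M \ G : Finset α) : Set α) ≤ ((q - 1 : ℕ) : ℕ∞) := by
    calc M.eRk ((gr M \ G : Finset α) : Set α) ≤ ((gr M \ G : Finset α) : Set α).encard := M.eRk_le_encard _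
      _ = ((q - 1 : ℕ) : ℕ∞) := by rw [Set.encard_coe_eq_coe_finsetCard, hd]
  have h2' : M.eRk ((G \ B : Finset α) : Set α) ≤ ((G \ B).card : ℕ∞) := by
    calc M.eRk ((G \ B : Finset α) : Set α) ≤ ((G \ B : Finset α) : Set α).encard := M.eRk_le_encard _
      _ = ((G \ B).card : ℕ∞) := by rw [Set.encard_coe_eq_coe_finsetCard]
  rw [hr] at hsub
  have h3 : ((q + 2 : ℕ) : ℕ∞) ≤ ((q - 1 : ℕ) : ℕ∞) + ((G \ B).card : ℕ∞) := hsub.trans (add_le_add h1 h2')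
  have h4 : q + 2 ≤ (q - 1) + (G \ B).card := by exact_mod_cast h3
  have hBcard : B.card = kColoops M G + 2 := by
    rw [kColoops_eq_card_coloops, ← h2, ← Finset.card_union_of_disjoint Finset.disjoint_sdiff,
      Finset.union_sdiff_of_subset hK]
  have hGB : (G \ B).card = G.card - B.card := Finset.card_sdiff_of_subset hBG
  have hKG : (coloops M G).card ≤ G.card := Finset.card_le_card (hK.trans hBG)
  rw [kColoops_eq_card_coloops] at hBcard ⊢
  omega

open scoped Classical in
/-- **THE RIGID CELL AT EVERY `q ≥ 4`**: for a simple matroid, a rank-`(q+1)` flat `G` with `|E ∖ G| = q − 1`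
and `kColoops (M|G) = q − 2` satisfies the local form (LI_G). -/
theorem localShadowHall_rigid {q : ℕ} {G : Finset α} (hG : G ∈ flatsQ M (q + 1))
    (hd : (gr M \ G).card = q - 1) (hk : kColoops M G + 2 = q) (hq : 4 ≤ q)
    (hs : ∀ e ∈ gr M, ∀ f ∈ gr M, e ≠ f → rkN M {e, f} = 2) : LocalShadowHall M q G := by
  have hd' : (gr M \ G).card ≤ q := by omega
  apply localShadowHall_of_lossFair hG hd'
  intro B hB z hz
  by_cases hl : loss M q G B z = 0
  · rw [hl]
    exact mul_nonneg (rhoL_nonneg hG hd' B z) (lossIncome_nonneg hG hd' B z)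
  -- a lossy pair
  have hB' : B ∈ membersIn M (Uq M (q + 2) q) G := (mem_thinMembers.1 hB).1
  have hBU : B ∈ Uq M (q + 2) q := (mem_membersIn.1 hB').1
  have hzB : z ∉ B := notMem_of_notMem_clF hBU (Finset.mem_sdiff.1 hz).2
  have hK := coloops_subset_of_mem_thinMembers hG hd' hB
  have h2 : (B \ coloops M G).card = 2 := by
    by_contra hne
    have hge : 2 ≤ (B \ coloops M G).card := by
      have hr := eRk_sdiff_coloops_eq_two hG hd' hk hB
      have hle : M.eRk ((B \ coloops M G : Finset α) : Set α) ≤ ((B \ coloops M G).card : ℕ∞) := by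
        calc M.eRk ((B \ coloops M G : Finset α) : Set α) ≤ ((B \ coloops M G : Finset α) : Set α).encard :=
              M.eRk_le_encard _
          _ = ((B \ coloops M G).card : ℕ∞) := by rw [Set.encard_coe_eq_coe_finsetCard]
      rw [hr] at hle
      exact_mod_cast hle
    exact hl (loss_eq_zero_of_three_le hG hd hk hs hB (by omega) hz)
  have hn5 : 5 ≤ G.card - kColoops M G := five_le_of_pair hG hd hk hB h2
  set n := G.card - kColoops M G with hn
  have hr : (G \ insert z B).card = n - 3 := card_sdiff_insert_eq hG hd' hB h2 hz
  have hBcard : B.card = kColoops M G + 2 := by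
    rw [kColoops_eq_card_coloops, ← h2, ← Finset.card_union_of_disjoint Finset.disjoint_sdiff,
      Finset.union_sdiff_of_subset hK]
  have hb : (insert z B).card = q + 1 := by rw [Finset.card_insert_of_notMem hzB, hBcard]; omega
  have hT : (tgtSets M q G B z).card = 2 ^ (n - 3) - 1 := by rw [card_tgtSets hG hB' hz, hr]
  have hTpos : (0 : ℚ) < ((2 ^ (n - 3) - 1 : ℕ) : ℚ) := by
    have : 2 ≤ 2 ^ (n - 3) := by
      calc 2 = 2 ^ 1 := by norm_num
        _ ≤ 2 ^ (n - 3) := Nat.pow_le_pow_right (by norm_num) (by omega)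
    exact_mod_cast (by omega : 0 < 2 ^ (n - 3) - 1)
  -- the size bounds on the targets
  set u : ℕ → ℚ := fun s => 3 * ((s - kColoops M G).choose 3 : ℚ) * (lambdaR q / ((2 ^ (n - 3) - 1 : ℕ) : ℚ)) with hu_def
  set v : ℕ → ℚ := fun s => if s ≤ G.card - 2 then cPrime q else cDouble q with hv_def
  have hKS : ∀ S ∈ tgtSets M q G B z, coloops M G ⊆ S :=
    fun S hS => coloops_subset_of_mem_shadowAt (mem_tgtSets.1 hS).1
  have hSK : ∀ S ∈ tgtSets M q G B z, (S \ coloops M G).card = S.card - kColoops M G := by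
    intro S hS
    rw [Finset.card_sdiff_of_subset (hKS S hS), kColoops_eq_card_coloops]
  have h4 : ∀ S ∈ tgtSets M q G B z, 4 ≤ (S \ coloops M G).card := by
    intro S hS
    obtain ⟨-, hBS, hcard⟩ := mem_tgtSets.1 hS
    have hBS' : B ⊆ S := (Finset.subset_insert z B).trans hBS
    have hsub : (S \ B) ∪ (B \ coloops M G) ⊆ S \ coloops M G := by
      intro x hx
      rw [Finset.mem_union, Finset.mem_sdiff, Finset.mem_sdiff] at hx
      rw [Finset.mem_sdiff]
      rcases hx with ⟨hxS, hxB⟩ | ⟨hxB, hxK⟩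
      · exact ⟨hxS, fun h => hxB (hK h)⟩
      · exact ⟨hBS' hxB, hxK⟩
    have hdisj : Disjoint (S \ B) (B \ coloops M G) := by
      rw [Finset.disjoint_left]; intro x hx hx'
      exact (Finset.mem_sdiff.1 hx).2 (Finset.mem_sdiff.1 hx').1
    have := Finset.card_le_card hsub
    rw [Finset.card_union_of_disjoint hdisj, h2] at this
    omega
  have hu : ∀ S ∈ tgtSets M q G B z, pi2Mass M q G S ≤ u S.card := by
    intro S hS
    have := pi2Mass_le_rigid hG hd hk hs (mem_tgtSets.1 hS).1
    rw [hSK S hS] at this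
    simpa [hu_def, hn] using this
  have hv : ∀ S ∈ tgtSets M q G B z, v S.card ≤ cap2 M q G S := by
    intro S hS
    have hS' := (mem_tgtSets.1 hS).1
    have hSG : S ⊆ G := subset_G_of_mem_shadowAt hS'
    simp only [hv_def]
    split_ifs with hle
    · exact cap2_ge_cPrime hG hd hk hs hS' (h4 S hS)
    · push Not at hle
      have h1 : (G \ S).card ≤ 1 := by
        rw [Finset.card_sdiff_of_subset hSG]; omega
      exact cap2_ge_cDouble hG hd hk hs hS' (h4 S hS) h1
  have hv0 : ∀ S ∈ tgtSets M q G B z, 0 ≤ v S.card := by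
    intro S _
    simp only [hv_def]
    split_ifs
    · exact (cPrime_pos (by omega)).le
    · exact (cDouble_pos (by omega)).le
  have hinc := lossIncome_ge_of_bounds hG hd' hB hz hl u v hu hv hv0
  rw [hr, hb] at hinc
  -- the explicit sum is (2^{n−3} − 1) · rigidSum n q
  have hsum : ∑ j ∈ Finset.Icc 1 (n - 3), ((n - 3).choose j : ℚ) * (v (q + 1 + j) / u (q + 1 + j)) =
      ((2 ^ (n - 3) - 1 : ℕ) : ℚ) * Rigid.rigidSum n q := by
    unfold Rigid.rigidSum
    rw [Finset.mul_sum]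
    apply Finset.sum_congr rfl
    intro j hj
    rw [Finset.mem_Icc] at hj
    have hv' : v (q + 1 + j) = Rigid.cj n q j := by
      simp only [hv_def, Rigid.cj]
      have hiff : q + 1 + j ≤ G.card - 2 ↔ j + 5 ≤ n := by omega
      by_cases hc : j + 5 ≤ n
      · rw [if_pos (hiff.2 hc), if_pos hc, cPrime_eq q (by omega)]
      · rw [if_neg (fun h => hc (hiff.1 h)), if_neg hc, cDouble_eq q]
    have hu' : u (q + 1 + j) = 3 * ((j + 3).choose 3 : ℚ) * (Rigid.lamRig q / ((2 ^ (n - 3) - 1 : ℕ) : ℚ)) := by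
      simp only [hu_def]
      rw [show q + 1 + j - kColoops M G = j + 3 by omega, lambdaR_eq q (by omega)]
    rw [hv', hu']
    have hj3 := Rigid.choose_succ_three_pos j
    have hlam : 0 < Rigid.lamRig q := by
      unfold Rigid.lamRig
      have : (4 : ℚ) ≤ (q : ℚ) := by exact_mod_cast hq
      apply div_pos _ (by positivity); nlinarith
    field_simp
  rw [hsum] at hinc
  -- conclude: loss ≤ (loss/|Tgt|) · lossIncome
  have hone := Rigid.one_le_rigidSum hn5 hq
  unfold rhoL
  rw [hT]
  have hl' : 0 < loss M q G B z := lt_of_le_of_ne (loss_nonneg' hG hd' B z) (Ne.symm hl)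
  calc loss M q G B z = loss M q G B z / ((2 ^ (n - 3) - 1 : ℕ) : ℚ) * ((2 ^ (n - 3) - 1 : ℕ) : ℚ) := by
        field_simp
    _ ≤ loss M q G B z / ((2 ^ (n - 3) - 1 : ℕ) : ℚ) * (((2 ^ (n - 3) - 1 : ℕ) : ℚ) * Rigid.rigidSum n q) := by
        apply mul_le_mul_of_nonneg_left _ (div_nonneg hl'.le hTpos.le)
        nlinarith [hone, hTpos]
    _ ≤ loss M q G B z / ((2 ^ (n - 3) - 1 : ℕ) : ℚ) * lossIncome M q G B z :=
        mul_le_mul_of_nonneg_left hinc (div_nonneg hl'.le hTpos.le)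

open scoped Classical in
/-- The open `(7, 5)` cell `(|E ∖ G|, kColoops) = (4, 3)` at `q = 5`: a simple matroid, a rank-`6` flat `G` with
`|E ∖ G| = 4` and `kColoops (M|G) = 3` satisfies the local form at `q = 5`. -/
theorem localShadowHall_four_three_five {G : Finset α} (hG : G ∈ flatsQ M (5 + 1))
    (hd : (gr M \ G).card = 4) (hk : kColoops M G = 3)
    (hs : ∀ e ∈ gr M, ∀ f ∈ gr M, e ≠ f → rkN M {e, f} = 2) : LocalShadowHall M 5 G :=
  localShadowHall_rigid hG (by rw [hd]) (by rw [hk]) (by norm_num) hs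

open scoped Classical in
/-- The cell `(3, 2)` at `q = 4` (a second proof of the g13 cell): a simple matroid, a rank-`5` flat `G` with
`|E ∖ G| = 3` and `kColoops (M|G) = 2` satisfies the local form at `q = 4`. -/
theorem localShadowHall_three_two_four {G : Finset α} (hG : G ∈ flatsQ M (4 + 1))
    (hd : (gr M \ G).card = 3) (hk : kColoops M G = 2)
    (hs : ∀ e ∈ gr M, ∀ f ∈ gr M, e ≠ f → rkN M {e, f} = 2) : LocalShadowHall M 4 G :=
  localShadowHall_rigid hG (by rw [hd]) (by rw [hk]) (by norm_num) hs

end PercRepro.Shadow
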